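import Literature.Computability.Complexity.FKFinalCheck
import Literature.Computability.Complexity.DrivenSignMachineStrategy
import Literature.Computability.Complexity.SignQueryPadding
import Literature.Computability.Complexity.NPClosureProofs
import HarnessLib

/-!
# The oracle-driven sign machine, VII: a generic verdict language (the point code sits in the last witness)

Topic `Literature/Computability/Complexity`, grouping namespace `FKTransfer`. The verdict piece
`Lfinal` of a driver (`DrivenSignMachineDriver.driverLang`) has to answer, on the full transcript
`⟨1ⁿ, flat code h⟩`, Fournier–Koiran's final `NP` question at the located rational point
(`FKFinalCheck.FinalCheck M q T` on `⟨1ⁿ, ratCode d N⟩`; ICALP 2000 = LIP RR-1999-21, p. 11). If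
the strategy lets the LAST witness carry the (zero-padded) code `ratCode d N` of that point in its
first `r(n)` bits — found and certified by the last prefix search like any other object — then the
verdict language is problem-independent:

* `finalSliceFn P r` — `⟨1ⁿ, bits⟩ ↦ ⟨1ⁿ, canonQ ((bits ⇂ (|bits| - P(n))) ↾ r(n))⟩`: cut the field
  out of the last block and re-encode it canonically (`SignRat.canonQ = encode ∘ decode`, which
  strips the padding: `canonQ_encode_append`); it is in `FP` (bricks);
* `FinalLang M q T P r := finalSliceFn P r ⁻¹' FinalCheck M q T`, **`FinalLang_mem_NP`**
  (`preimage_mem_NP`, `FinalCheck_mem_NP`);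
* **`mem_FinalLang_flat_iff`**: on `flat code (h₀ ++ [(w, b)])` with `|w| = s`, codes of length `m`,
  `P = s + m + 1`, `r ≤ s` and `w ↾ r = ratCode d N ++ pad`, membership is
  `⟨1ⁿ, ratCode d N⟩ ∈ FinalCheck M q T` — hypothesis (4) of
  `FKTransferAssembly.mem_PAddRelClass_of_strategy` for such strategies.

## References

* H. Fournier, P. Koiran, *Lower bounds are not easier over the reals: inside PH*, ICALP 2000,
  LNCS 1853 = LIP RR-1999-21, Thm 3 (p. 11: the final `NP` question at a small rational point).
  [FournierKoiran2000]
-/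

namespace Literature.Computability.Complexity

namespace FKTransfer

open _root_.Computability Polynomial Brick

/-- Length of a unary numeral. [folklore] -/
private theorem length_unaryEncodeNat (k : ℕ) : (unaryEncodeNat k).length = k := by
  induction k with
  | zero => rfl
  | succ k ih => rw [unaryEncodeNat, List.length_cons, ih]

/-- Unary numerals are blocks of ones. [folklore] -/
private theorem unaryEncodeNat_eq_ones (k : ℕ) : unaryEncodeNat k = ones k := by
  induction k with
  | zero => rfl
  | succ k ih => rw [unaryEncodeNat, ih]; rfl

/-- **Decoding a padded integer-list code** (`SignQueryPadding.listBool_decode_encode_append`, read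
through the total decoder). [folklore] -/
theorem decodeInts_encode_append (l : List ℤ) (pad : List Bool) :
    decodeInts ((encodingIntBool.listBool).encode l ++ pad) = l := by
  rw [decodeInts, listBool_decode_encode_append]; rfl

/-- **Canonical re-encoding strips padding**: `canonQ (code l ++ pad) = code l`. [folklore] -/
theorem canonQ_encode_append (l : List ℤ) (pad : List Bool) :
    canonQ ((encodingIntBool.listBool).encode l ++ pad) = (encodingIntBool.listBool).encode l := by
  rw [canonQ_apply, decodeInts_encode_append, CodeFP.listE_eq]
  rfl

/-! ### The slicing map and the verdict language -/

section Final

variable (M : OracleAlg Bool) (q T P r : Polynomial ℕ)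

/-- `⟨1ⁿ, bits⟩ ↦ ⟨1ⁿ, canonQ ((bits ⇂ (|bits| - P(n))) ↾ r(n))⟩`: the first `r(n)` bits of the last
`P(n)`-block, canonically re-encoded. [folklore] -/
noncomputable def finalSliceFn : List Bool → List Bool :=
  fanoutFn fstF (canonQ ∘ Plumb.takeFn ∘ fanoutFn (Plumb.polyFn r ∘ fstF)
    (Plumb.dropFn ∘ fanoutFn (Plumb.dropFn ∘ fanoutFn (Plumb.polyFn P ∘ fstF) (onesFn ∘ sndF)) sndF))

/-- **The generic verdict language**: the sliced, re-encoded point code passes the final check.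
[cite: FournierKoiran2000, Thm 3 (p. 11)] -/
def FinalLang : Language Bool :=
  finalSliceFn P r ⁻¹' FinalCheck M q T

variable {M q T P r}

/-- Value of the slicing map. [folklore] -/
theorem finalSliceFn_apply (n : ℕ) (bits : List Bool) :
    finalSliceFn P r (boolPair (unaryEncodeNat n) bits) =
      boolPair (unaryEncodeNat n) (canonQ (((bits.drop (bits.length - P.eval n)).take (r.eval n)))) := by
  simp only [finalSliceFn, Function.comp_apply, fanoutFn_apply, fstF_boolPair, sndF_boolPair,
    Plumb.polyFn_apply, length_unaryEncodeNat, onesFn, Plumb.dropFn_boolPair, Plumb.takeFn_boolPair]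
  rw [unaryEncodeNat_eq_ones bits.length, show ((ones bits.length).drop (ones (P.eval n)).length).length =
    bits.length - P.eval n by simp [ones], show (ones (r.eval n)).length = r.eval n by simp [ones]]

/-- `finalSliceFn ∈ FP`. [folklore] -/
theorem finalSliceFn_mem_FP : finalSliceFn P r ∈ FP :=
  fanoutFn_mem_FP fstF_mem_FP (comp_mem_FP canonQ_mem_FP (comp_mem_FP Plumb.takeFn_mem_FP
    (fanoutFn_mem_FP (comp_mem_FP (Plumb.polyFn_mem_FP r) fstF_mem_FP)
      (comp_mem_FP Plumb.dropFn_mem_FP (fanoutFn_mem_FP (comp_mem_FP Plumb.dropFn_mem_FP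
        (fanoutFn_mem_FP (comp_mem_FP (Plumb.polyFn_mem_FP P) fstF_mem_FP) (comp_mem_FP onesFn_mem_FP sndF_mem_FP)))
        sndF_mem_FP)))))

/-- **The generic verdict language is in `NP`** when the verifier is polynomial-time.
[cite: FournierKoiran2000, Thm 3 (p. 12: "a standard NP algorithm")] -/
theorem FinalLang_mem_NP (hM : M.IsPolyTime encodingBoolBool) : FinalLang M q T P r ∈ Nondeterministic.NP :=
  preimage_mem_NP (FinalCheck_mem_NP hM) finalSliceFn_mem_FP

/-- Membership of a transcript in the verdict language. [folklore] -/
theorem mem_FinalLang_iff {n : ℕ} {bits : List Bool} :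
    boolPair (unaryEncodeNat n) bits ∈ FinalLang M q T P r ↔
      boolPair (unaryEncodeNat n) (canonQ ((bits.drop (bits.length - P.eval n)).take (r.eval n))) ∈
        FinalCheck M q T := by
  have h : (boolPair (unaryEncodeNat n) bits ∈ FinalLang M q T P r) ↔
      finalSliceFn P r (boolPair (unaryEncodeNat n) bits) ∈ FinalCheck M q T := Iff.rfl
  rw [h, finalSliceFn_apply]

/-- **The verdict on a full transcript whose last witness carries the point code.** With witnesses
of length `s`, codes of length `m`, `P(n) = s + m + 1`, `r(n) ≤ s`, and the last witness `w` beginning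
with `ratCode d N` zero-padded to `r(n)` bits: `⟨1ⁿ, flat code (h₀ ++ [(w, b)])⟩ ∈ FinalLang` iff
`⟨1ⁿ, ratCode d N⟩ ∈ FinalCheck M q T`. [cite: FournierKoiran2000, Thm 3 (p. 11)] -/
theorem mem_FinalLang_flat_iff {n s m : ℕ} {code : List (List Bool × Bool) → List Bool → List Bool}
    (hcode : ∀ h w, (code h w).length = m) (hP : P.eval n = s + m + 1) (hr : r.eval n ≤ s)
    (h₀ : List (List Bool × Bool)) {w : List Bool} (hw : w.length = s) (b : Bool)
    {d : ℕ} {N : List ℤ} {pad : List Bool} (hpt : w.take (r.eval n) = ratCode d N ++ pad) :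
    boolPair (unaryEncodeNat n) (flat code (h₀ ++ [(w, b)])) ∈ FinalLang M q T P r ↔
      boolPair (unaryEncodeNat n) (ratCode d N) ∈ FinalCheck M q T := by
  rw [mem_FinalLang_iff, flat_append_singleton, hP]
  have hfr : (w ++ code h₀ w ++ [b]).length = s + m + 1 := by
    simp only [List.length_append, hw, hcode, List.length_singleton]
  have hlenB : (flat code h₀ ++ (w ++ code h₀ w ++ [b])).length - (s + m + 1) = (flat code h₀).length := by
    rw [List.length_append, hfr]; omega
  have hslice : ((flat code h₀ ++ (w ++ code h₀ w ++ [b])).drop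
      ((flat code h₀ ++ (w ++ code h₀ w ++ [b])).length - (s + m + 1))).take (r.eval n) = ratCode d N ++ pad := by
    rw [hlenB, List.drop_left, List.append_assoc, List.take_append_of_le_length (by rw [hw]; exact hr), hpt]
  rw [hslice, ratCode, canonQ_encode_append]

end Final

end FKTransfer

end Literature.Computability.Complexity
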